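import Literature.Geometry.Lorentzian.NonRotatingBlackHoleUniqueness
import Literature.Geometry.Lorentzian.StaticBlackHoleUniquenessProofs
import Literature.Geometry.Lorentzian.StaticKillingLapseEquation
import Literature.Geometry.Lorentzian.ConnectionNaturality
import Literature.Geometry.Lorentzian.StationaryOrbitHorizontalFlow
import Literature.Geometry.Lorentzian.GaussFormulaTangentialGeneral
import HarnessLib

-- v2 (same provefact seat, 2026-08-16): + step (S7) along a slice and the covering step (S8)
-- (`IsKillingField.twistForm_eq_zero_of_eq_smul_normal`, `….isHypersurfaceOrthogonalOn_of_slices`,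
-- `StationaryAFBlackHole.isHypersurfaceOrthogonalOn_doc_of_slices`, `SudarskyWald1993_staticity_of_exists_slices`;
-- imports StaticKillingLapseEquation); v1 (p86593) unchanged.
-- v3: + step (S8) proper — the twist form is invariant under isometries preserving `X`
-- (`mfderiv_leviCivita_of_isometry`, `twistForm_mfderiv_of_isometry`, `IsHypersurfaceOrthogonalOn.image_of_isometry`),
-- staticity spreads along the stationary flow (`StationaryAFBlackHole.IsHypersurfaceOrthogonalOn.stationaryOrbit`),
-- single-slice forms `isHypersurfaceOrthogonalOn_doc_of_slice`, `SudarskyWald1993_staticity_of_exists_slice`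
-- (imports ConnectionNaturality, StationaryOrbitHorizontalFlow); v1/v2 unchanged.
-- v4: + step (S0) — the horizon hypothesis in the tree's standard form (`StationaryAFBlackHole.isNonDegenerateHorizon_of_killing`,
-- `isNull_killing_of_mem_horizon`, `isIPlusRegularNonDegenerate_of_killing`); v1–v3 (p86593, p89077, p92298) unchanged.
/-!
# Staticity of non-rotating black holes (Sudarsky–Wald): proved glue lemmas

Companion (proofs-only) file of `Literature.Geometry.Lorentzian.NonRotatingBlackHoleUniqueness`,
which records the staticity theorem for non-rotating, non-degenerate, `I⁺`-regular vacuum black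
holes (Sudarsky–Wald 1993, on the maximal hypersurface of Chruściel–Wald 1994, the bifurcate
horizon being attached by Rácz–Wald 1996; printed in full for `I⁺`-regular vacuum space-times in
Chruściel–Costa, Astérisque 321 (2008) = arXiv:0806.0016, §7.2, and quoted in
Chruściel–Costa–Heusler, *Living Rev. Relativity* 15 (2012) 7 = arXiv:1205.6112, §3.3.1 and §4.1)
as the named fact `SudarskyWald1993_staticity` (D-0014).

## Status of the named fact (provefact seat, 2026-08-16)

The statement was audited clause by clause against Chruściel–Costa 2008, §7.2 and
Chruściel–Costa–Heusler 2012, §3.3.1 / §4.1 ("staticity of `I⁺`-regular, vacuum,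
asymptotically-flat, non-rotating, non-degenerate black holes") and found faithful: the horizon
hypothesis (`T ≠ 0` and `∇_T T = κ T` on `𝓔⁺`, one constant `κ ≠ 0`) makes `T` null on `𝓔⁺`
(`IsKillingField.val_self_eq_zero_of_leviCivita_eq_smul`) with `d(g(T, T)) = -2κ T♭ ≠ 0` there
(`IsKillingField.val_leviCivita_eq_neg_mul_of_leviCivita_eq_smul`), which is the printed opening
"by hypothesis `∇(g(X, X))` has no zeros on `𝓔⁺`, so all components of the future event horizon
are non-degenerate" of §7.2; no analyticity is assumed in print for this step; the conclusion is
staticity of `⟨⟨M_ext⟩⟩` only, as printed ("Hence `⟨⟨M_ext⟩⟩` is static as well"). Not mis-stated.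

Its printed proof (Chruściel–Costa 2008, §7.2) is a chain of theories none of which exists in
Mathlib or in `Literature/`:

* (S1) replace `(M, g)` by `(M', g')` containing `⟨⟨M_ext⟩⟩' ≅ ⟨⟨M_ext⟩⟩` in which every component
  of `𝓔⁺` lies on a bifurcate Killing horizon with bifurcation surface `S` (Rácz–Wald 1996 with
  Chruściel–Costa's Corollary 4.x);
* (S2) a Cauchy surface `Σ'` of `⟨⟨M_ext⟩⟩'` with `∂Σ' = S` (null hypersurfaces of auxiliary
  metrics `g_ε` issued from `S`, Jacobi fields, smoothing);
* (S3) an asymptotically flat **maximal** Cauchy hypersurface `Σ''` of `⟨⟨M_ext⟩⟩` with `∂Σ'' = S`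
  (Chruściel–Wald 1994, on Bartnik's 1984 quasilinear elliptic theory);
* (S4) the `3 + 1` split `X' = N n + Z` of the Killing field along `Σ''`: `D_i Z_j + D_j Z_i =
  -2N K_{ij}` ((7.1)), and with the vacuum momentum constraint `D_i K^{ij} = 0` on the maximal
  slice, `D_i (K^{ij} Z_j) = -N K^{ij} K_{ij}`;
* (S5) integration over `Σ''`, the boundary terms vanishing by asymptotic decay and by `Z = N = 0`
  on `S`: `∫_{Σ''} N |K|² = 0`;
* (S6) the lapse equation `ΔN = |K|² N` and the maximum principle: `N > 0` off `∂Σ''`, so `K ≡ 0`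
  (and then `Z`, a Killing field of `(Σ'', g_{ij})` vanishing on `S` and at infinity, vanishes);
* (S7) "staticity of `⟨⟨M_ext⟩⟩'` along `Σ''` follows";
* (S8) moving `Σ''` with the isometry group one covers `⟨⟨M_ext⟩⟩'` (Chruściel–Wald 1994), so
  `⟨⟨M_ext⟩⟩'`, hence `⟨⟨M_ext⟩⟩`, is static.

The fact stays a named fact; this file proves the steps expressible in the tree's vocabulary.

## What is proved here (v1): step (S7), pointwise

Step (S7) is a pointwise statement about the Killing field `X` at a point `x` of the slice: by
(S6) the slice is totally geodesic (`K = 0`) and `X = N n` is normal to it, so `∇X` vanishes on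
`X^⊥ × X^⊥` (for `u, w` tangent to the slice, `g(∇_u X, w) = g(∇_u (N n), w) = u(N) g(n, w) +
N K(u, w) = 0`), and THIS implies `X♭ ∧ dX♭ = 0` at `x`. We prove the implication in the
connection form of the tree (`twistForm`, `IsHypersurfaceOrthogonalOn` of
`StaticBlackHoleUniqueness.lean`), as the converse of the pointwise Vishveshwara–Carter identity
`IsHypersurfaceOrthogonalOn.val_leviCivita_eq_zero_of_orthogonal` of
`StaticBlackHoleUniquenessProofs.lean`:

* `PseudoRiemannianMetric.twistForm_eq_zero_of_antisymm_eq_wedge` — the easy direction of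
  Frobenius' theorem, pointwise and for any vector field: if `dX♭ = α ∧ X♭` at `x` (in connection
  form, `g(∇_v X, w) - g(∇_w X, v) = α(v) X♭(w) - α(w) X♭(v)`), then `(X♭ ∧ dX♭)_x = 0`
  (Wald 1984, App. B.3, Thm. B.3.2 / (B.3.6));
* `PseudoRiemannianMetric.IsKillingField.exists_val_leviCivita_eq_wedge_of_orthogonal` — for a
  Killing field `X` with `X(x) ≠ 0`: if `g(∇_u X, w) = 0` for all `u, w ∈ X(x)^⊥`, then
  `∇X♭ = β ⊗ X♭ - X♭ ⊗ β` at `x` for the one-form `β = g(∇· X, t)`, `t` any transversal with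
  `X♭(t) = 1`;
* `PseudoRiemannianMetric.IsKillingField.twistForm_eq_zero_of_orthogonal` — hence
  `(X♭ ∧ dX♭)_x = 0` (also when `X(x) = 0`, trivially);
* `PseudoRiemannianMetric.IsKillingField.isHypersurfaceOrthogonalOn_of_orthogonal`,
  `….isHypersurfaceOrthogonalOn_iff_orthogonal` — on a set `A` (on which `X` has no zeros, for the
  `iff`): **a Killing field is hypersurface-orthogonal on `A` iff `∇X` vanishes on `X^⊥ × X^⊥` at
  every point of `A`**, i.e. iff the distribution `X^⊥` is (pointwise) totally geodesic — for
  timelike `X` this is `K = 0` for the slices orthogonal to `X` with `X = N n`, the output of (S6);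
* `StationaryAFBlackHole.IsIPlusRegular.isHypersurfaceOrthogonalOn_doc_iff` — for the stationary
  Killing field of an `I⁺`-regular black hole, which has no zeros on `⟨⟨M_ext⟩⟩` (Chruściel–Costa
  2008, Cor. 3.8, `IsIPlusRegular.killing_ne_zero_of_mem_doc`): **`⟨⟨M_ext⟩⟩` is static iff
  `g(∇_u T, w) = 0` for all `u, w ⊥ T` at every point of `⟨⟨M_ext⟩⟩`** — the form in which steps
  (S3)–(S6) and (S8) deliver the conclusion of `SudarskyWald1993_staticity`
  (`SudarskyWald1993_staticity_of_forall_orthogonal`).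

## What is proved here (v2): step (S7) along a slice, and step (S8)

With the hypersurface calculus of `StaticKillingLapseEquation.lean` (for a spacelike immersion
`f : Nᵐ → Mᵐ⁺¹` with unit normal `ν` of sign `ε ≠ 0`: `T_{f y} M = df(T_y N) ⊕ ℝν`,
`eq_zero_of_val_mfderiv_eq_zero_of_val_normal_eq_zero`; and `∇_{df u} X = dV(u) ν` for
`X ∘ f = V ν` at a point where `K_ν = 0`, `leviCivita_mfderiv_eq_of_eq_smul_normal`) the
pointwise criterion becomes the printed step (S7) itself:

* `PseudoRiemannianMetric.IsKillingField.twistForm_eq_zero_of_eq_smul_normal` — **if the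
  Killing field `X` is `V ν` along a spacelike immersed hypersurface with unit normal `ν`, then at
  every point `y` with `K_ν(y) = 0` and `V(y) ≠ 0` the twist form of `X` vanishes at `f y`**:
  `∇X♭ = β ⊗ X♭ - X♭ ⊗ β` at `f y` with `β = g(∇· X, ν)/(εV)`, checked on the generators `df u`
  (where `∇_{df u} X = dV(u) ν`) and `ν` (Killing skewness) and extended to `T_{f y} M` by
  nondegeneracy; this is "`K_{ij} = 0`, `Z = 0` on `Σ''` `⟹` staticity along `Σ''`"
  (Chruściel–Costa 2008, §7.2; Sudarsky–Wald 1993, Thms. 1–2);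
* `PseudoRiemannianMetric.IsKillingField.isHypersurfaceOrthogonalOn_of_slices` — step (S8) as
  glue: a family of such slices covering `A` (every point of `A` is some `f i y` with
  `K_{ν i}(y) = 0`, `V i y ≠ 0`) makes `X` hypersurface-orthogonal on `A` ("moving the `Σ''`'s
  with the isometry group one covers `⟨⟨M_ext⟩⟩'`");
* `StationaryAFBlackHole.isHypersurfaceOrthogonalOn_doc_of_slices` — the same for the stationary
  Killing field and the d.o.c. of a `StationaryAFBlackHole` (slices modelled on `ℝ³`, future unit
  normals, `dim = 3 + 1`);
* `SudarskyWald1993_staticity_of_exists_slices` — hence the named fact follows from the output of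
  steps (S1)–(S6), (S8): the existence, under its hypotheses, of such a covering family of
  `T`-normal slices totally geodesic where they pass (in print, the flow-translates of the
  Chruściel–Wald maximal slice after `∫ N|K|² = 0`, `N > 0`). What remains un-formalised is
  exactly that existence statement: the Rácz–Wald extension (S1), the Cauchy surface through the
  bifurcation surface (S2), the Chruściel–Wald maximal slice (S3), the integral identity with
  its boundary behaviour (S4)–(S5) and the maximum principle for the lapse equation (S6).

## What is proved here (v3): step (S8) proper — staticity is carried by the stationary flow

In print the covering family is not arbitrary: it is the set of flow-translates `φₜ(Σ'')` of ONE
slice, and staticity along `φₜ(Σ'')` is staticity along `Σ''` transported by the isometry `φₜ`.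
With the naturality of the Levi-Civita connection under local diffeomorphisms
(`leviCivita_comap_mpullback_apply`, `ConnectionNaturality.lean`; O'Neill 1983, Ch. 3,
Prop. 3.59) and the stationary flow of `KillingFlowIsometry.lean` (`exists_stationary_flow`:
smooth, group law, isometric; `mfderiv_flow_apply_self`: `dφₜ T = T ∘ φₜ`,
`StationaryOrbitHorizontalFlow.lean`) this step is proved as well:

* `PseudoRiemannianMetric.mfderiv_leviCivita_of_isometry` — for a smooth map `Φ : M → M` with
  injective differentials, isometric (`g(dΦ v, dΦ w) = g(v, w)`) and preserving the differentiable
  field `X` (`dΦ X = X ∘ Φ`): `dΦ(∇_v X) = ∇_{dΦ v} X` (the pullback metric `Φ^*g` is `g` and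
  `Φ^*X = X`);
* `PseudoRiemannianMetric.twistForm_mfderiv_of_isometry`,
  `PseudoRiemannianMetric.IsHypersurfaceOrthogonalOn.image_of_isometry` — hence the twist form is
  `Φ`-invariant and `X♭ ∧ dX♭ = 0` on `A` gives `X♭ ∧ dX♭ = 0` on `Φ(A)`;
* `StationaryAFBlackHole.IsHypersurfaceOrthogonalOn.stationaryOrbit` — **staticity of the
  stationary Killing field on `A` spreads to the orbit `⋃ₜ φₜ(A)`** (`stationaryOrbit T A`);
* `StationaryAFBlackHole.isHypersurfaceOrthogonalOn_doc_of_slice`,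
  `SudarskyWald1993_staticity_of_exists_slice` — single-slice forms of the reduction: the named
  fact follows from the existence, under its hypotheses, of ONE spacelike immersed `3`-slice with
  future unit normal `ν`, `T ∘ f = V ν` with `V ≠ 0` (zero shift), `K_ν ≡ 0`, whose orbit
  `⋃ₜ φₜ(f(N))` contains `⟨⟨M_ext⟩⟩` — which is precisely what steps (S1)–(S6) establish for the
  Chruściel–Wald maximal Cauchy surface `Σ''` (`K = 0`, `Z = 0`, `N > 0`; Cauchy for
  `⟨⟨M_ext⟩⟩' ⊇ ⟨⟨M_ext⟩⟩`, hence swept out by the flow).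

## What is proved here (v4): step (S0) — the horizon hypothesis in the tree's standard form

* `StationaryAFBlackHole.isNonDegenerateHorizon_of_killing` — under the horizon hypothesis of the
  named fact (`T ≠ 0` and `∇_T T = κ T` on `𝓔⁺`, `κ ≠ 0`) the future event horizon is a
  non-degenerate horizon **of the stationary Killing field itself** in the sense of
  `LorentzianMetric.IsNonDegenerateHorizon` (the horizon hypothesis of
  `ChruscielCosta2008_uniqueness`), the tangency clause being the flow-invariance of `𝓔⁺`
  (`mem_horizon_of_isMIntegralCurve`); `….isNull_killing_of_mem_horizon` — `T` is null on `𝓔⁺`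
  ("non-rotating"); `….isIPlusRegularNonDegenerate_of_killing` — with a connected horizon, `𝓑` is
  `IsIPlusRegularNonDegenerate`. This is the opening sentence of Chruściel–Costa 2008, §7.2.

## What is proved here (v5): step (S4) with zero shift — the `K = 0` hypothesis is redundant

Chruściel–Costa's (7.1), `D_i Z_j + D_j Z_i = -2N K_{ij}` for a Killing field `X = N n + Z` along
a spacelike slice, is proved in general form in `GaussFormulaTangentialGeneral.lean`
(`IsKillingField.inducedMetric_val_leviCivita_shift_symm_add`, on top of the tangential Gauss
formula for arbitrary tangent fields). With zero shift it says that a slice everywhere normal to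
a Killing field is totally geodesic where the lapse does not vanish:

* `IsKillingField.secondFundamentalForm_eq_zero_of_eq_smul_normal`,
  `IsKillingField.isTotallyGeodesic_of_eq_smul_normal` — `X ∘ f = V ν`, `V(y) ≠ 0` `⟹`
  `K_ν(y) = 0`;
* `IsKillingField.twistForm_eq_zero_of_eq_smul_normal'`,
  `StationaryAFBlackHole.isHypersurfaceOrthogonalOn_doc_of_normal_slice`,
  `SudarskyWald1993_staticity_of_exists_normal_slice` — the (S7)/(S8) statements and the
  single-slice reduction of v2/v3 with the hypothesis `K_ν ≡ 0` removed.

So the named fact is reduced to: under its hypotheses there is ONE spacelike immersed `3`-slice to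
which `T` is everywhere normal with nowhere-vanishing lapse and whose flow-orbit contains
`⟨⟨M_ext⟩⟩` — the output of (S1)–(S3), (S5)–(S6) and the covering half of (S8), which remain the
theories absent from the tree.

## References

* P. T. Chruściel, J. L. Costa, *On uniqueness of stationary vacuum black holes*, Astérisque 321
  (2008) 195–265, arXiv:0806.0016, §7.2 (key `ChruscielCosta2008`).
* P. T. Chruściel, J. L. Costa, M. Heusler, *Stationary black holes: uniqueness and beyond*,
  Living Rev. Relativity 15 (2012) 7, arXiv:1205.6112, §3.3.1, §3.4.1, §4.1
  (key `ChruscielCostaHeusler2012`).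
* D. Sudarsky, R. M. Wald, *Mass formulas for stationary Einstein–Yang–Mills black holes and a
  simple proof of two staticity theorems*, Phys. Rev. D 47 (1993) R5209–R5213, Thms. 1–2.
* P. T. Chruściel, R. M. Wald, *Maximal hypersurfaces in stationary asymptotically flat
  spacetimes*, Commun. Math. Phys. 163 (1994) 561–604, Thm. 4.2.
* R. M. Wald, *General Relativity*, Chicago 1984, §7.1, (7.1.1) and App. B.3, Thm. B.3.2
  (key `Wald1984`).
* B. O'Neill, *Semi-Riemannian geometry*, Academic Press 1983, Ch. 3, Prop. 3.59 (isometries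
  preserve the Levi-Civita connection), Ch. 9, Prop. 9.23 (Killing flows are isometries),
  Prop. 9.25 (key `ONeillSemiRiemannian1983` / `ONeill1983`).
* J. M. Lee, *Introduction to Smooth Manifolds*, 2nd ed., GTM 218, Springer 2012, Thm. 9.12
  (flows) (key `LeeSmoothManifolds2013`).
-/

noncomputable section

open Set Bundle
open scoped ContDiff Manifold

universe u

namespace Literature.Geometry.Lorentzian

/-! ### Frobenius, easy direction, pointwise -/

namespace PseudoRiemannianMetric

variable {E : Type*} [NormedAddCommGroup E] [NormedSpace ℝ E] {H : Type*} [TopologicalSpace H]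
  {I : ModelWithCorners ℝ E H} {M : Type*} [TopologicalSpace M] [ChartedSpace H M]
  [IsManifold I ∞ M] {n : ℕ∞ω}
  {g : PseudoRiemannianMetric I n E (TangentSpace I : M → Type _)} [g.HasLeviCivita]

/-- **Frobenius, easy direction (pointwise).** If at the point `x` the exterior derivative of
`X♭` is a multiple of `X♭`, `dX♭ = α ∧ X♭` — in connection form (torsion-free, metric `∇`):
`g(∇_v X, w) - g(∇_w X, v) = α(v) X♭(w) - α(w) X♭(v)` for all `v, w` and some function `α` on
`T_x M` — then the twist form `(X♭ ∧ dX♭)_x` vanishes: `X♭ ∧ α ∧ X♭ = 0`. This is the trivial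
half of Frobenius' theorem in its dual formulation (Wald 1984, App. B.3, Thm. B.3.2 and (B.3.6):
`X` hypersurface orthogonal iff `X_{[a} ∇_b X_{c]} = 0`; if `X♭ = -λ dτ` then
`dX♭ = d log|λ| ∧ X♭`). [cite: Wald1984, App. B.3, Thm. B.3.2 and (B.3.6)] -/
theorem twistForm_eq_zero_of_antisymm_eq_wedge {X : Π x : M, TangentSpace I x} {x : M}
    (α : TangentSpace I x → ℝ)
    (h : ∀ v w : TangentSpace I x,
      g.val x (g.leviCivita X x v) w - g.val x (g.leviCivita X x w) v =
        α v * g.val x (X x) w - α w * g.val x (X x) v)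
    (u v w : TangentSpace I x) : g.twistForm X x u v w = 0 := by
  simp only [twistForm]
  rw [h v w, h w u, h u v]
  ring

/-- **Killing version.** For a Killing field `dX♭ = 2 ∇X♭`, so the hypothesis of
`twistForm_eq_zero_of_antisymm_eq_wedge` reads: `∇X♭ = β ⊗ X♭ - X♭ ⊗ β` at `x`, i.e.
`g(∇_v X, w) = β(v) X♭(w) - β(w) X♭(v)` for all `v, w`; then `(X♭ ∧ dX♭)_x = 0`. Wald 1984, §7.1,
(7.1.1) and App. B.3. [cite: Wald1984, §7.1 (7.1.1) and App. B.3] -/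
theorem IsKillingField.twistForm_eq_zero_of_val_leviCivita_eq_wedge
    {X : Π x : M, TangentSpace I x} (hX : g.IsKillingField X) {x : M}
    (β : TangentSpace I x → ℝ)
    (h : ∀ v w : TangentSpace I x,
      g.val x (g.leviCivita X x v) w = β v * g.val x (X x) w - β w * g.val x (X x) v)
    (u v w : TangentSpace I x) : g.twistForm X x u v w = 0 := by
  rw [hX.twistForm_eq, h v w, h w u, h u v]
  ring

/-- **`∇X` of a Killing field is determined by its restriction to `X^⊥ × X^⊥` up to a wedge with
`X♭`.** Let `X` be a Killing field with `X(x) ≠ 0` and suppose `g(∇_u X, w) = 0` for all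
`u, w ∈ X(x)^⊥`. Pick `t` with `X♭(t) = g(X, t) ≠ 0` (nondegeneracy) and put
`β(v) := g(∇_v X, t) / X♭(t)`. Then for all `v, w`: `g(∇_v X, w) = β(v) X♭(w) - β(w) X♭(v)` —
split `v = v' + (X♭(v)/X♭(t)) t`, `w = w' + (X♭(w)/X♭(t)) t` with `v', w' ∈ X^⊥`, expand
`0 = g(∇_{v'} X, w')` bilinearly, and use `g(∇_t X, t) = 0`, `g(∇_t X, w) = -g(∇_w X, t)` (Killing
antisymmetry). This is the pointwise algebra behind "`K = 0` and `X = N n` on the slice `⟹`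
`dX♭ ∝ d log N ∧ X♭`", the last step of the staticity argument (Chruściel–Costa 2008, §7.2:
"Staticity of `⟨⟨M_ext⟩⟩'` along `Σ''` follows"; Sudarsky–Wald 1993). [cite: ChruscielCosta2008, §7.2 (last paragraph: staticity along the maximal slice)] -/
theorem IsKillingField.exists_val_leviCivita_eq_wedge_of_orthogonal
    {X : Π x : M, TangentSpace I x} (hX : g.IsKillingField X) {x : M} (hne : X x ≠ 0)
    (h : ∀ u w : TangentSpace I x, g.val x (X x) u = 0 → g.val x (X x) w = 0 →
      g.val x (g.leviCivita X x u) w = 0) :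
    ∃ β : TangentSpace I x → ℝ, ∀ v w : TangentSpace I x,
      g.val x (g.leviCivita X x v) w = β v * g.val x (X x) w - β w * g.val x (X x) v := by
  obtain ⟨t₀, ht₀⟩ := g.exists_val_ne_zero_of_ne_zero x hne
  -- normalise the transversal: `X♭(t) = 1`
  set t : TangentSpace I x := (g.val x (X x) t₀)⁻¹ • t₀ with ht
  have ht1 : g.val x (X x) t = 1 := by
    simp only [ht, map_smul, smul_eq_mul]
    exact inv_mul_cancel₀ ht₀
  refine ⟨fun v ↦ g.val x (g.leviCivita X x v) t, fun v w ↦ ?_⟩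
  -- the `X^⊥`-components `v'`, `w'` of `v` and `w`
  have hv'0 : g.val x (X x) (v - g.val x (X x) v • t) = 0 := by
    simp only [map_sub, map_smul, smul_eq_mul, ht1, mul_one, sub_self]
  have hw'0 : g.val x (X x) (w - g.val x (X x) w • t) = 0 := by
    simp only [map_sub, map_smul, smul_eq_mul, ht1, mul_one, sub_self]
  have h0 := h _ _ hv'0 hw'0
  -- expand `g(∇_{v'} X, w') = 0` bilinearly
  have htt : g.val x (g.leviCivita X x t) t = 0 := hX.val_leviCivita_apply_self x t
  have htw : g.val x (g.leviCivita X x t) w = -g.val x (g.leviCivita X x w) t :=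
    hX.val_leviCivita_antisymm x t w
  simp only [map_sub, map_smul, smul_eq_mul, FunLike.coe_sub,
    FunLike.coe_smul, Pi.sub_apply, Pi.smul_apply] at h0
  rw [htt, htw] at h0
  linear_combination h0

/-- **Pointwise Frobenius criterion for Killing fields (converse of the Vishveshwara–Carter
identity `IsHypersurfaceOrthogonalOn.val_leviCivita_eq_zero_of_orthogonal`).** If `X` is a
Killing field and, at the point `x`, `g(∇_u X, w) = 0` for all `u, w ∈ X(x)^⊥`, then the twist
form `(X♭ ∧ dX♭)_x` vanishes. (If `X(x) = 0` every slot of the twist form carries a factor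
`X♭ = 0`; otherwise combine `exists_val_leviCivita_eq_wedge_of_orthogonal` with
`twistForm_eq_zero_of_val_leviCivita_eq_wedge`.) Where `X` is timelike and `X = N n` is the
normal of a slice with second fundamental form `K`, the hypothesis is `K = 0` at `x`: this is the
step "`K_{ij} = 0` on the maximal slice `⟹` staticity along the slice" of the Sudarsky–Wald
argument as printed by Chruściel–Costa 2008, §7.2. [cite: ChruscielCosta2008, §7.2 (staticity along the maximal slice)] -/
theorem IsKillingField.twistForm_eq_zero_of_orthogonal
    {X : Π x : M, TangentSpace I x} (hX : g.IsKillingField X) {x : M}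
    (h : ∀ u w : TangentSpace I x, g.val x (X x) u = 0 → g.val x (X x) w = 0 →
      g.val x (g.leviCivita X x u) w = 0)
    (u v w : TangentSpace I x) : g.twistForm X x u v w = 0 := by
  by_cases hne : X x = 0
  · simp [twistForm, hne]
  · obtain ⟨β, hβ⟩ := hX.exists_val_leviCivita_eq_wedge_of_orthogonal hne h
    exact hX.twistForm_eq_zero_of_val_leviCivita_eq_wedge β hβ u v w

/-- **A Killing field whose orthogonal distribution is (pointwise) totally geodesic on `A` is
hypersurface-orthogonal on `A`**: if at every `x ∈ A`, `g(∇_u X, w) = 0` for all `u, w ⊥ X(x)`,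
then `X♭ ∧ dX♭ = 0` on `A` (`IsHypersurfaceOrthogonalOn`). Chruściel–Costa 2008, §7.2 (staticity
of `⟨⟨M_ext⟩⟩'` from `K = 0` along the maximal slices covering it); Wald 1984, App. B.3. [cite: ChruscielCosta2008, §7.2 (staticity along the maximal slice)] -/
theorem IsKillingField.isHypersurfaceOrthogonalOn_of_orthogonal
    {X : Π x : M, TangentSpace I x} (hX : g.IsKillingField X) {A : Set M}
    (h : ∀ x ∈ A, ∀ u w : TangentSpace I x, g.val x (X x) u = 0 → g.val x (X x) w = 0 →
      g.val x (g.leviCivita X x u) w = 0) :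
    g.IsHypersurfaceOrthogonalOn X A :=
  fun x hx u v w ↦ hX.twistForm_eq_zero_of_orthogonal (h x hx) u v w

/-- **Pointwise Frobenius criterion for Killing fields, `iff` form.** For a Killing field `X`
without zeros on `A`: `X` is hypersurface-orthogonal on `A` (`X♭ ∧ dX♭ = 0` there) **iff** at every
point of `A`, `g(∇_u X, w) = 0` for all `u, w ∈ X^⊥` — the orthogonal distribution `X^⊥` is
totally geodesic (pointwise form; for timelike `X`: the slices orthogonal to `X` are totally
geodesic, `K = 0`). (`⟹` is `IsHypersurfaceOrthogonalOn.val_leviCivita_eq_zero_of_orthogonal`,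
Chruściel–Costa–Heusler 2012, §2.5.2; `⟸` is `isHypersurfaceOrthogonalOn_of_orthogonal`.)
Wald 1984, App. B.3 with §7.1; Chruściel–Costa 2008, §7.2. [cite: Wald1984, App. B.3, Thm. B.3.2 (with §7.1 (7.1.1))] -/
theorem IsKillingField.isHypersurfaceOrthogonalOn_iff_orthogonal
    {X : Π x : M, TangentSpace I x} (hX : g.IsKillingField X) {A : Set M}
    (hne : ∀ x ∈ A, X x ≠ 0) :
    g.IsHypersurfaceOrthogonalOn X A ↔
      ∀ x ∈ A, ∀ u w : TangentSpace I x, g.val x (X x) u = 0 → g.val x (X x) w = 0 →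
        g.val x (g.leviCivita X x u) w = 0 :=
  ⟨fun hA x hx _ _ hu hw ↦ hA.val_leviCivita_eq_zero_of_orthogonal hX hx (hne x hx) hu hw,
    hX.isHypersurfaceOrthogonalOn_of_orthogonal⟩

end PseudoRiemannianMetric

/-! ### The criterion for the stationary Killing field on the domain of outer communications -/

namespace StationaryAFBlackHole

variable {𝓑 : StationaryAFBlackHole.{u}}

/-- **`⟨⟨M_ext⟩⟩` is static iff the orthogonal distribution of the stationary Killing field is
totally geodesic there.** For an `I⁺`-regular stationary AF black hole the stationary Killing
field `T` has no zeros on `⟨⟨M_ext⟩⟩` (Chruściel–Costa 2008, Cor. 3.8, tree theorem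
`IsIPlusRegular.killing_ne_zero_of_mem_doc`), so by the pointwise Frobenius criterion
(`IsKillingField.isHypersurfaceOrthogonalOn_iff_orthogonal`): `T♭ ∧ dT♭ = 0` on `⟨⟨M_ext⟩⟩` iff
`g(∇_u T, w) = 0` for all `u, w ⊥ T` at every point of `⟨⟨M_ext⟩⟩`. The right-hand side is what
the Sudarsky–Wald argument establishes along the maximal slices `Σ''` covering `⟨⟨M_ext⟩⟩'`
(`K = 0`, `T = N n`; Chruściel–Costa 2008, §7.2). [cite: ChruscielCosta2008, §7.2 (with Cor. 3.8)] -/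
theorem IsIPlusRegular.isHypersurfaceOrthogonalOn_doc_iff [𝓑.metric.HasLeviCivita]
    (hreg : 𝓑.IsIPlusRegular) :
    𝓑.metric.toPseudoRiemannianMetric.IsHypersurfaceOrthogonalOn 𝓑.killing 𝓑.doc ↔
      ∀ x ∈ 𝓑.doc, ∀ u w : TangentSpace (𝓡 4) x,
        𝓑.metric.val x (𝓑.killing x) u = 0 → 𝓑.metric.val x (𝓑.killing x) w = 0 →
          𝓑.metric.val x (𝓑.metric.toPseudoRiemannianMetric.leviCivita 𝓑.killing x u) w = 0 :=
  𝓑.isStationaryKilling.isKillingField.isHypersurfaceOrthogonalOn_iff_orthogonal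
    fun _ hx ↦ hreg.killing_ne_zero_of_mem_doc hx

end StationaryAFBlackHole

/-- **Reduction of `SudarskyWald1993_staticity` to the pointwise output of the maximal-slice
argument.** If, under the hypotheses of the named fact (`I⁺`-regular, vacuum, `𝓔⁺ ≠ ∅`, `T ≠ 0`
and `∇_T T = κ T` on `𝓔⁺` with `κ ≠ 0`), the orthogonal distribution of the stationary Killing
field `T` is totally geodesic at every point of `⟨⟨M_ext⟩⟩` — `g(∇_u T, w) = 0` for `u, w ⊥ T`,
which is what steps (S1)–(S6), (S8) of Chruściel–Costa 2008, §7.2 prove (`K = 0`, `T = N n` along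
maximal slices covering `⟨⟨M_ext⟩⟩`) — then `SudarskyWald1993_staticity` holds (step (S7),
`IsKillingField.isHypersurfaceOrthogonalOn_of_orthogonal`). A theorem with that output as
hypothesis, not a discharge of the fact. [cite: ChruscielCosta2008, §7.2] -/
theorem SudarskyWald1993_staticity_of_forall_orthogonal
    (h : ∀ (𝓑 : StationaryAFBlackHole.{0}) [𝓑.metric.HasLeviCivita],
      𝓑.IsIPlusRegular → 𝓑.metric.toPseudoRiemannianMetric.IsRicciFlat → 𝓑.horizon.Nonempty →
      (∀ p ∈ 𝓑.horizon, 𝓑.killing p ≠ 0) →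
      (∃ κ : ℝ, κ ≠ 0 ∧ ∀ p ∈ 𝓑.horizon,
        𝓑.metric.leviCivita 𝓑.killing p (𝓑.killing p) = κ • 𝓑.killing p) →
      ∀ x ∈ 𝓑.doc, ∀ u w : TangentSpace (𝓡 4) x,
        𝓑.metric.val x (𝓑.killing x) u = 0 → 𝓑.metric.val x (𝓑.killing x) w = 0 →
          𝓑.metric.val x (𝓑.metric.toPseudoRiemannianMetric.leviCivita 𝓑.killing x u) w = 0) :
    SudarskyWald1993_staticity :=
  fun 𝓑 _ hreg hvac hne hT hκ ↦
    𝓑.isStationaryKilling.isKillingField.isHypersurfaceOrthogonalOn_of_orthogonal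
      (h 𝓑 hreg hvac hne hT hκ)

end Literature.Geometry.Lorentzian

/-! ### Step (S7) along a totally geodesic slice: `K = 0`, `X = V ν` `⟹` `X♭ ∧ dX♭ = 0` -/

namespace Literature.Geometry.Lorentzian

namespace PseudoRiemannianMetric

variable {E : Type*} [NormedAddCommGroup E] [NormedSpace ℝ E] {H : Type*} [TopologicalSpace H]
  {I : ModelWithCorners ℝ E H} {M : Type*} [TopologicalSpace M] [ChartedSpace H M]
  [IsManifold I ∞ M] [FiniteDimensional ℝ E] [CompleteSpace E]
  {g : PseudoRiemannianMetric I ∞ E (TangentSpace I : M → Type _)} [g.HasLeviCivita]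
  {E' : Type*} [NormedAddCommGroup E'] [NormedSpace ℝ E'] {H' : Type*} [TopologicalSpace H']
  {I' : ModelWithCorners ℝ E' H'} {N : Type*} [TopologicalSpace N] [ChartedSpace H' N]
  [IsManifold I' ∞ N] [FiniteDimensional ℝ E'] [I'.Boundaryless] {f : N → M}
  {ν : NormalField I f} {ε : ℝ}

/-- **Staticity along a totally geodesic slice normal to the Killing field (step (S7) of the
Sudarsky–Wald argument, pointwise).** Let `f : Nᵐ → Mᵐ⁺¹` be a spacelike immersion with unit
normal `ν` of sign `ε ≠ 0` (smooth lift), `X` a Killing field with `X ∘ f = V ν` for a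
differentiable lapse `V`, and `y` a point with `V(y) ≠ 0` at which the second fundamental form
vanishes, `K_ν(y) = 0`. Then the twist form of `X` vanishes at `f y`: `(X♭ ∧ dX♭)_{f y} = 0`.
Indeed `∇_{df u} X = dV(u) ν` (`leviCivita_mfderiv_eq_of_eq_smul_normal`) and the Killing
equation give `∇X♭ = β ⊗ X♭ - X♭ ⊗ β` at `f y` with `β = g(∇· X, ν)/(ε V)` — checked on the
generators `df u`, `ν` of `T_{f y} M = df(T_y N) ⊕ ℝν` and extended by nondegeneracy
(`eq_zero_of_val_mfderiv_eq_zero_of_val_normal_eq_zero`) — whence `X♭ ∧ dX♭ = 0`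
(`IsKillingField.twistForm_eq_zero_of_val_leviCivita_eq_wedge`). This is "`K_{ij} = 0` [and
`Z = 0`, i.e. `X = N n`] on `Σ''` `⟹` staticity of `⟨⟨M_ext⟩⟩'` along `Σ''`" in Chruściel–Costa's
rendering of Sudarsky–Wald (Chruściel–Costa 2008, §7.2, last paragraph; Sudarsky–Wald 1993,
Thms. 1–2); for `g = -V² dt² + γ` it is the statement that `∂ₜ = V n` is hypersurface-orthogonal when
the slices `{t = const}` are totally geodesic. [cite: ChruscielCosta2008, §7.2 (last paragraph: K = 0 on the maximal slice gives staticity along it)] -/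
theorem IsKillingField.twistForm_eq_zero_of_eq_smul_normal
    (hfi : g.IsSpacelikeImmersion I' f) (hun : g.IsUnitNormal I' f ν ε) (hε : ε ≠ 0)
    (hν : ContMDiff I' I.tangent ∞
      (fun x ↦ (TotalSpace.mk' E (f x) (ν x) : TangentBundle I M)))
    (hdim : Module.finrank ℝ E = Module.finrank ℝ E' + 1)
    {X : Π x : M, TangentSpace I x} (hX : g.IsKillingField X)
    {V : N → ℝ} (hVd : ∀ y, MDifferentiableAt I' 𝓘(ℝ, ℝ) V y)
    (hprop : ∀ y, X (f y) = V y • ν y) {y : N}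
    (hK : g.secondFundamentalForm I' f ν y = 0) (hVy : V y ≠ 0)
    (u v w : TangentSpace I (f y)) : g.twistForm X (f y) u v w = 0 := by
  -- tangential derivatives `∇_{df u'} X = dV(u') ν`, normality, `X = V ν` at `f y`
  have hT : ∀ u' : TangentSpace I' y,
      g.leviCivita X (f y) (mfderiv I' I f y u') = mvfderiv I' V y u' • ν y := fun u' ↦
    g.leviCivita_mfderiv_eq_of_eq_smul_normal hfi hun hε hν hdim hX.mdifferentiableAt hVd
      hprop hK u'
  have hνν : g.val (f y) (ν y) (ν y) = ε := hun.val_self y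
  have hν0 : ∀ u' : TangentSpace I' y, g.val (f y) (ν y) (mfderiv I' I f y u') = 0 :=
    fun u' ↦ hun.isNormalTo y u'
  have hXp : X (f y) = V y • ν y := hprop y
  have hc : ε * V y ≠ 0 := mul_ne_zero hε hVy
  -- Killing antisymmetry and skewness at `f y`
  have hanti : ∀ a b : TangentSpace I (f y),
      g.val (f y) (g.leviCivita X (f y) a) b = -g.val (f y) (g.leviCivita X (f y) b) a :=
    fun a b ↦ hX.val_leviCivita_antisymm (f y) a b
  have hskew : ∀ a : TangentSpace I (f y), g.val (f y) (g.leviCivita X (f y) a) a = 0 :=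
    fun a ↦ hX.val_leviCivita_apply_self (f y) a
  -- the one-form `β = g(∇· X, ν) / (ε V)`
  set β : TangentSpace I (f y) → ℝ :=
    fun z ↦ g.val (f y) (g.leviCivita X (f y) z) (ν y) / (ε * V y) with hβ
  -- the wedge identity with first slot tangential
  have hA : ∀ (u' : TangentSpace I' y) (z : TangentSpace I (f y)),
      g.val (f y) (g.leviCivita X (f y) (mfderiv I' I f y u')) z =
        β (mfderiv I' I f y u') * g.val (f y) (X (f y)) z -
          β z * g.val (f y) (X (f y)) (mfderiv I' I f y u') := by
    intro u' z
    simp only [hβ, hT u', hXp, map_smul, FunLike.coe_smul, Pi.smul_apply, smul_eq_mul, hνν,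
      hν0 u', mul_zero, sub_zero]
    field_simp
  -- the wedge identity with first slot normal
  have hB : ∀ z : TangentSpace I (f y),
      g.val (f y) (g.leviCivita X (f y) (ν y)) z =
        β (ν y) * g.val (f y) (X (f y)) z - β z * g.val (f y) (X (f y)) (ν y) := by
    intro z
    simp only [hβ, hskew (ν y), zero_div, zero_mul, zero_sub, hXp, map_smul, FunLike.coe_smul,
      Pi.smul_apply, smul_eq_mul, hνν]
    rw [hanti (ν y) z]
    field_simp
  -- the wedge identity in general, by nondegeneracy on `T_{f y} M = df(T_y N) ⊕ ℝ ν`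
  have hgen : ∀ v' z : TangentSpace I (f y),
      g.val (f y) (g.leviCivita X (f y) v') z =
        β v' * g.val (f y) (X (f y)) z - β z * g.val (f y) (X (f y)) v' := by
    intro v' z
    -- `g(A, ·)` is the defect of the identity in its first slot
    set A : TangentSpace I (f y) :=
      (g.val (f y) (X (f y)) z / (ε * V y)) • g.leviCivita X (f y) (ν y) +
        β z • X (f y) - g.leviCivita X (f y) z with hAdef
    have hdef : ∀ a : TangentSpace I (f y), g.val (f y) A a =
        g.val (f y) (g.leviCivita X (f y) a) z - β a * g.val (f y) (X (f y)) z +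
          β z * g.val (f y) (X (f y)) a := by
      intro a
      simp only [hAdef, hβ, map_sub, map_add, map_smul, FunLike.coe_sub, FunLike.coe_add,
        FunLike.coe_smul, Pi.sub_apply, Pi.add_apply, Pi.smul_apply, smul_eq_mul]
      rw [hanti z a, hanti (ν y) a]
      field_simp
      ring
    have hA0 : A = 0 := by
      refine g.eq_zero_of_val_mfderiv_eq_zero_of_val_normal_eq_zero hfi hν0 hνν hε hdim
        (fun u' ↦ ?_) ?_
      · rw [hdef]
        have := hA u' z
        linarith
      · rw [hdef]
        have := hB z
        linarith
    have h0 := hdef v'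
    rw [hA0, map_zero, zero_apply] at h0
    linarith
  exact hX.twistForm_eq_zero_of_val_leviCivita_eq_wedge β hgen u v w

/-- **Steps (S7)–(S8): a Killing field normal to a family of slices which are totally geodesic
where they pass is hypersurface-orthogonal on the region they cover.** Let `f i : Nᵐ → Mᵐ⁺¹`
(`i : ι`) be spacelike immersions with unit normals `ν i` of sign `ε ≠ 0` (smooth lifts) and
`X` a Killing field with `X ∘ f i = V i • ν i` for differentiable lapses `V i`. If every point of
`A` is some `f i y` with `K_{ν i}(y) = 0` and `V i y ≠ 0`, then `X♭ ∧ dX♭ = 0` on `A`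
(`twistForm_eq_zero_of_eq_smul_normal` at each point). In Chruściel–Costa's proof the family is
the flow-translates `φ_t(Σ'')` of the maximal slice, on which `K = 0` and `X = N n` by the
integral identity and the maximum principle, and "moving the `Σ''`'s with the isometry group one
covers `⟨⟨M_ext⟩⟩'` [Chruściel–Wald 1994], and staticity of `⟨⟨M_ext⟩⟩'` follows"
(Chruściel–Costa 2008, §7.2). [cite: ChruscielCosta2008, §7.2 (last paragraph: moving the maximal slice by the isometries covers the d.o.c.)] -/
theorem IsKillingField.isHypersurfaceOrthogonalOn_of_slices {ι : Type*} {f : ι → N → M}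
    {ν : Π i, NormalField I (f i)} {V : ι → N → ℝ}
    (hfi : ∀ i, g.IsSpacelikeImmersion I' (f i)) (hun : ∀ i, g.IsUnitNormal I' (f i) (ν i) ε)
    (hε : ε ≠ 0)
    (hν : ∀ i, ContMDiff I' I.tangent ∞
      (fun x ↦ (TotalSpace.mk' E (f i x) (ν i x) : TangentBundle I M)))
    (hdim : Module.finrank ℝ E = Module.finrank ℝ E' + 1)
    {X : Π x : M, TangentSpace I x} (hX : g.IsKillingField X)
    (hVd : ∀ i y, MDifferentiableAt I' 𝓘(ℝ, ℝ) (V i) y)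
    (hprop : ∀ i y, X (f i y) = V i y • ν i y) {A : Set M}
    (hcover : ∀ x ∈ A, ∃ i y, f i y = x ∧
      g.secondFundamentalForm I' (f i) (ν i) y = 0 ∧ V i y ≠ 0) :
    g.IsHypersurfaceOrthogonalOn X A := by
  intro x hx u v w
  obtain ⟨i, y, rfl, hK, hVy⟩ := hcover x hx
  exact hX.twistForm_eq_zero_of_eq_smul_normal (hfi i) (hun i) hε (hν i) hdim (hVd i) (hprop i)
    hK hVy u v w

end PseudoRiemannianMetric

/-! ### The same for the stationary Killing field of a black-hole space-time -/

namespace StationaryAFBlackHole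

variable {𝓑 : StationaryAFBlackHole.{u}}

/-- **The domain of outer communications is static as soon as it is covered by slices normal to
the stationary Killing field which are totally geodesic where they pass** (steps (S7)–(S8) of
the Sudarsky–Wald argument for the hypothesis structure `StationaryAFBlackHole`): given spacelike
immersed `3`-slices `f i : N → M` with future unit normals `ν i` (smooth lifts) and
differentiable lapses `V i` with `T ∘ f i = V i • ν i` (`T = 𝓑.killing`), such that every point
of `⟨⟨M_ext⟩⟩` is some `f i y` with `K_{ν i}(y) = 0`, `V i y ≠ 0`, the stationary Killing field
is hypersurface-orthogonal on `⟨⟨M_ext⟩⟩`. (The maximal slices `φ_t(Σ'')` of Chruściel–Wald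
1994, on which Sudarsky–Wald's identity forces `K = 0` and `Z = 0`, are such a family;
Chruściel–Costa 2008, §7.2.) [cite: ChruscielCosta2008, §7.2 (last paragraph)] -/
theorem isHypersurfaceOrthogonalOn_doc_of_slices [𝓑.metric.HasLeviCivita]
    {N : Type*} [TopologicalSpace N] [ChartedSpace E3 N] [IsManifold (𝓡 3) ∞ N]
    {ι : Type*} {f : ι → N → 𝓑.carrier} {ν : Π i, NormalField (𝓡 4) (f i)} {V : ι → N → ℝ}
    (hfi : ∀ i, 𝓑.metric.toPseudoRiemannianMetric.IsSpacelikeImmersion (𝓡 3) (f i))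
    (hun : ∀ i, 𝓑.metric.IsFutureUnitNormal (𝓡 3) 𝓑.timeOrientation (f i) (ν i))
    (hν : ∀ i, ContMDiff (𝓡 3) (𝓡 4).tangent ∞
      (fun x ↦ (TotalSpace.mk' E4 (f i x) (ν i x) : TangentBundle (𝓡 4) 𝓑.carrier)))
    (hVd : ∀ i y, MDifferentiableAt (𝓡 3) 𝓘(ℝ, ℝ) (V i) y)
    (hprop : ∀ i y, 𝓑.killing (f i y) = V i y • ν i y)
    (hcover : ∀ x ∈ 𝓑.doc, ∃ i y, f i y = x ∧
      𝓑.metric.toPseudoRiemannianMetric.secondFundamentalForm (𝓡 3) (f i) (ν i) y = 0 ∧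
        V i y ≠ 0) :
    𝓑.metric.toPseudoRiemannianMetric.IsHypersurfaceOrthogonalOn 𝓑.killing 𝓑.doc :=
  𝓑.isStationaryKilling.isKillingField.isHypersurfaceOrthogonalOn_of_slices hfi
    (fun i ↦ (hun i).1) (by norm_num)
    hν (by rw [finrank_euclideanSpace_fin, finrank_euclideanSpace_fin]) hVd hprop hcover

end StationaryAFBlackHole

/-- **Reduction of `SudarskyWald1993_staticity` to the output of the maximal-slice argument
(steps (S1)–(S6), (S8) of Chruściel–Costa 2008, §7.2).** If, under the hypotheses of the named
fact, the domain of outer communications is covered by spacelike immersed `3`-slices normal to the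
stationary Killing field `T` (`T ∘ f i = V i • ν i`, `V i ≠ 0`) which are totally geodesic where
they pass (`K_{ν i}(y) = 0`) — in print: the flow-translates of the Chruściel–Wald maximal Cauchy
slice `Σ''` of `⟨⟨M_ext⟩⟩'`, on which `∫ N |K|² = 0` and `N > 0` force `K = 0`, `Z = 0` — then the
named fact holds, by `StationaryAFBlackHole.isHypersurfaceOrthogonalOn_doc_of_slices` (steps
(S7)–(S8)). A theorem with that output as hypothesis, not a discharge of the fact. [cite: ChruscielCosta2008, §7.2] -/
theorem SudarskyWald1993_staticity_of_exists_slices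
    (h : ∀ (𝓑 : StationaryAFBlackHole.{0}) [𝓑.metric.HasLeviCivita],
      𝓑.IsIPlusRegular → 𝓑.metric.toPseudoRiemannianMetric.IsRicciFlat → 𝓑.horizon.Nonempty →
      (∀ p ∈ 𝓑.horizon, 𝓑.killing p ≠ 0) →
      (∃ κ : ℝ, κ ≠ 0 ∧ ∀ p ∈ 𝓑.horizon,
        𝓑.metric.leviCivita 𝓑.killing p (𝓑.killing p) = κ • 𝓑.killing p) →
      ∃ (N : Type) (_ : TopologicalSpace N) (_ : ChartedSpace E3 N) (_ : IsManifold (𝓡 3) ∞ N)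
        (ι : Type) (f : ι → N → 𝓑.carrier) (ν : Π i, NormalField (𝓡 4) (f i)) (V : ι → N → ℝ),
        (∀ i, 𝓑.metric.toPseudoRiemannianMetric.IsSpacelikeImmersion (𝓡 3) (f i)) ∧
        (∀ i, 𝓑.metric.IsFutureUnitNormal (𝓡 3) 𝓑.timeOrientation (f i) (ν i)) ∧
        (∀ i, ContMDiff (𝓡 3) (𝓡 4).tangent ∞
          (fun x ↦ (TotalSpace.mk' E4 (f i x) (ν i x) : TangentBundle (𝓡 4) 𝓑.carrier))) ∧
        (∀ i y, MDifferentiableAt (𝓡 3) 𝓘(ℝ, ℝ) (V i) y) ∧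
        (∀ i y, 𝓑.killing (f i y) = V i y • ν i y) ∧
        ∀ x ∈ 𝓑.doc, ∃ i y, f i y = x ∧
          𝓑.metric.toPseudoRiemannianMetric.secondFundamentalForm (𝓡 3) (f i) (ν i) y = 0 ∧
            V i y ≠ 0) :
    SudarskyWald1993_staticity := by
  intro 𝓑 _ hreg hvac hne hT hκ
  obtain ⟨N, _, _, _, ι, f, ν, V, hfi, hun, hν, hVd, hprop, hcover⟩ := h 𝓑 hreg hvac hne hT hκ
  exact StationaryAFBlackHole.isHypersurfaceOrthogonalOn_doc_of_slices hfi hun hν hVd hprop hcover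

/-! ### Step (S8): staticity is transported by isometries preserving `X`, in particular by the
flow of `X` -/

namespace PseudoRiemannianMetric

variable {E : Type*} [NormedAddCommGroup E] [NormedSpace ℝ E] {H : Type*} [TopologicalSpace H]
  {I : ModelWithCorners ℝ E H} {M : Type*} [TopologicalSpace M] [ChartedSpace H M]
  [IsManifold I ∞ M] [FiniteDimensional ℝ E] [CompleteSpace E]
  {g : PseudoRiemannianMetric I ∞ E (TangentSpace I : M → Type _)} [g.HasLeviCivita]

/-- **Isometries preserving `X` preserve `∇X`: `dΦ(∇_v X) = ∇_{dΦ v} X`.** Let `Φ : M → M` be a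
smooth map with injective (hence invertible) differentials which is isometric,
`g_{Φ y}(dΦ v, dΦ w) = g_y(v, w)`, and let `X` be a differentiable vector field with
`dΦ_y(X_y) = X_{Φ y}`. Then `dΦ_y(∇_v X) = (∇_{dΦ_y v} X)(Φ y)`: the pullback metric `Φ^* g`
(`comap`) IS `g` and `Φ^* X = X`, so this is the naturality of the Levi-Civita connection
(`leviCivita_comap_mpullback_apply`, O'Neill 1983, Ch. 3, Prop. 3.59: isometries preserve the
Levi-Civita connection). [cite: ONeill1983, Ch. 3, Prop. 3.59] -/
theorem mfderiv_leviCivita_of_isometry {Φ : M → M} (hΦ : ContMDiff I I (∞ + 1) Φ)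
    (hΦ' : ∀ y, Function.Injective (mfderiv I I Φ y))
    (hiso : ∀ (y : M) (v w : TangentSpace I y),
      g.val (Φ y) (mfderiv I I Φ y v) (mfderiv I I Φ y w) = g.val y v w)
    {X : Π x : M, TangentSpace I x} (hXd : ∀ x, MDiffAt (T% X) x)
    (hXΦ : ∀ y, mfderiv I I Φ y (X y) = X (Φ y)) (y : M) (v : TangentSpace I y) :
    mfderiv I I Φ y (g.leviCivita X y v) = g.leviCivita X (Φ y) (mfderiv I I Φ y v) := by
  have hpb : contMDiff_pullbackBilin I M I M ∞ := contMDiff_pullbackBilin_holds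
  have hdim : Module.finrank ℝ E = Module.finrank ℝ E := rfl
  -- `Φ^* g = g`
  have hgg : g.comap hpb Φ hΦ hΦ' hdim = g := by
    ext y v w
    rw [val_comap, pullbackBilin_apply, hiso]
  -- `Φ^* X = X`
  have hpull : VectorField.mpullback I I Φ X = X := by
    funext u
    rw [VectorField.mpullback_apply, ← hXΦ u]
    exact (isInvertible_mfderiv_of_injective hdim (hΦ' u)).inverse_apply_self _
  haveI : (g.comap hpb Φ hΦ hΦ' hdim).HasLeviCivita := (g.comap hpb Φ hΦ hΦ' hdim).hasLeviCivita
  have key := leviCivita_comap_mpullback_apply g hpb hΦ hΦ' hdim (hXd (Φ y)) v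
  rw [hpull] at key
  -- transport from `Φ^* g` to `g` (the Levi-Civita instance is a proposition)
  have aux : ∀ (g' : PseudoRiemannianMetric I ∞ E (TangentSpace I : M → Type _))
      [g'.HasLeviCivita], g' = g →
      g'.leviCivita X y v =
        (mfderiv I I Φ y).inverse (g.leviCivita X (Φ y) (mfderiv I I Φ y v)) →
      g.leviCivita X y v =
        (mfderiv I I Φ y).inverse (g.leviCivita X (Φ y) (mfderiv I I Φ y v)) := by
    intro g' _ hg h
    subst hg
    exact h
  rw [aux _ hgg key]
  exact (isInvertible_mfderiv_of_injective hdim (hΦ' y)).self_apply_inverse _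

/-- **The twist form is invariant under isometries preserving `X`**:
`(X♭ ∧ dX♭)_{Φ y}(dΦ u, dΦ v, dΦ w) = (X♭ ∧ dX♭)_y(u, v, w)` — every pairing in the twist form is a
`g`-pairing of `X`, `∇X` and the arguments, all of which `Φ` transports
(`mfderiv_leviCivita_of_isometry`). O'Neill 1983, Ch. 3, Prop. 3.59 ff. (isometries preserve
everything built from `g` and `∇`); for the flow of the stationary Killing field this is the
invariance behind "moving the `Σ''`'s with the isometry group" (Chruściel–Costa 2008, §7.2). [cite: ONeill1983, Ch. 3, Prop. 3.59] -/
theorem twistForm_mfderiv_of_isometry {Φ : M → M} (hΦ : ContMDiff I I (∞ + 1) Φ)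
    (hΦ' : ∀ y, Function.Injective (mfderiv I I Φ y))
    (hiso : ∀ (y : M) (v w : TangentSpace I y),
      g.val (Φ y) (mfderiv I I Φ y v) (mfderiv I I Φ y w) = g.val y v w)
    {X : Π x : M, TangentSpace I x} (hXd : ∀ x, MDiffAt (T% X) x)
    (hXΦ : ∀ y, mfderiv I I Φ y (X y) = X (Φ y)) (y : M) (u v w : TangentSpace I y) :
    g.twistForm X (Φ y) (mfderiv I I Φ y u) (mfderiv I I Φ y v) (mfderiv I I Φ y w) =
      g.twistForm X y u v w := by
  have nat := fun a ↦ g.mfderiv_leviCivita_of_isometry hΦ hΦ' hiso hXd hXΦ y a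
  simp only [twistForm]
  rw [← hXΦ y, ← nat u, ← nat v, ← nat w]
  simp only [hiso]

/-- **Hypersurface-orthogonality is transported by isometries preserving `X`**: if
`X♭ ∧ dX♭ = 0` on `A`, then `X♭ ∧ dX♭ = 0` on `Φ(A)` (the differentials of `Φ` are onto, so every
triple at `Φ y` is an image triple; `twistForm_mfderiv_of_isometry`). O'Neill 1983, Ch. 3,
Prop. 3.59 ff.; Chruściel–Costa 2008, §7.2. [cite: ChruscielCosta2008, §7.2 (staticity carried along the isometry group)] -/
theorem IsHypersurfaceOrthogonalOn.image_of_isometry {Φ : M → M} (hΦ : ContMDiff I I (∞ + 1) Φ)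
    (hΦ' : ∀ y, Function.Injective (mfderiv I I Φ y))
    (hiso : ∀ (y : M) (v w : TangentSpace I y),
      g.val (Φ y) (mfderiv I I Φ y v) (mfderiv I I Φ y w) = g.val y v w)
    {X : Π x : M, TangentSpace I x} (hXd : ∀ x, MDiffAt (T% X) x)
    (hXΦ : ∀ y, mfderiv I I Φ y (X y) = X (Φ y)) {A : Set M}
    (h : g.IsHypersurfaceOrthogonalOn X A) : g.IsHypersurfaceOrthogonalOn X (Φ '' A) := by
  rintro _ ⟨y, hy, rfl⟩ u' v' w'
  have hdim : Module.finrank ℝ E = Module.finrank ℝ E := rfl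
  obtain ⟨u, rfl⟩ := (mfderiv_bijective_of_injective (hΦ' y) hdim).2 u'
  obtain ⟨v, rfl⟩ := (mfderiv_bijective_of_injective (hΦ' y) hdim).2 v'
  obtain ⟨w, rfl⟩ := (mfderiv_bijective_of_injective (hΦ' y) hdim).2 w'
  rw [g.twistForm_mfderiv_of_isometry hΦ hΦ' hiso hXd hXΦ y u v w]
  exact h y hy u v w

end PseudoRiemannianMetric

namespace StationaryAFBlackHole

variable {𝓑 : StationaryAFBlackHole.{u}}

/-- **Staticity spreads along the stationary flow**: if the stationary Killing field `T` of `𝓑`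
is hypersurface-orthogonal on `A`, it is hypersurface-orthogonal on the orbit
`⋃ₜ φₜ(A) = stationaryOrbit T A`. The flow maps `φₜ` (`exists_stationary_flow`: smooth, group
law, isometric, `KillingFlowIsometry.lean`) preserve `T` (`dφₜ T = T ∘ φₜ`,
`mfderiv_flow_apply_self`), hence `∇T` and the twist form
(`IsHypersurfaceOrthogonalOn.image_of_isometry`), and every point of the orbit is some `φₜ(a)`,
`a ∈ A` (`eq_flow_of_isMIntegralCurve`). This is "moving the `Σ''`'s with the isometry group one
covers `⟨⟨M_ext⟩⟩'`, and staticity of `⟨⟨M_ext⟩⟩'` follows" (Chruściel–Costa 2008, §7.2), given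
staticity along `Σ''`. [cite: ChruscielCosta2008, §7.2 (last paragraph)] -/
theorem IsHypersurfaceOrthogonalOn.stationaryOrbit [𝓑.metric.HasLeviCivita] {A : Set 𝓑.carrier}
    (h : 𝓑.metric.toPseudoRiemannianMetric.IsHypersurfaceOrthogonalOn 𝓑.killing A) :
    𝓑.metric.toPseudoRiemannianMetric.IsHypersurfaceOrthogonalOn 𝓑.killing
      (𝓑.toSpacetime.stationaryOrbit 𝓑.killing A) := by
  obtain ⟨θ, hθ, hθ0, hθadd, hθX, hiso, -⟩ := 𝓑.exists_stationary_flow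
  have hK : 𝓑.metric.IsKillingField 𝓑.killing := 𝓑.isStationaryKilling.isKillingField
  have hθ2 : ContMDiff (𝓘(ℝ, ℝ).prod (𝓡 4)) (𝓡 4) 2 θ := hθ.of_le (WithTop.coe_le_coe.mpr le_top)
  have hK1 : ContMDiff (𝓡 4) (𝓡 4).tangent 1
      (fun x ↦ (⟨x, 𝓑.killing x⟩ : TangentBundle (𝓡 4) 𝓑.carrier)) :=
    hK.contMDiff.of_le (WithTop.coe_le_coe.mpr le_top)
  rintro x ⟨γ, hγ, hγ0, t, rfl⟩ u v w
  -- `γ t = φₜ (γ 0)` with `γ 0 ∈ A`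
  have hx : γ t ∈ (fun q ↦ θ (t, q)) '' A :=
    ⟨γ 0, hγ0, (eq_flow_of_isMIntegralCurve hK1 hθX hθ0 hγ t).symm⟩
  have hΦ : ContMDiff (𝓡 4) (𝓡 4) (∞ + 1) (fun q ↦ θ (t, q)) := by
    have h1 : ContMDiff (𝓡 4) (𝓡 4) ∞ (fun q ↦ θ (t, q)) :=
      hθ.comp (contMDiff_const.prodMk contMDiff_id)
    exact h1.of_le le_rfl
  have hΦ' : ∀ y, Function.Injective (mfderiv (𝓡 4) (𝓡 4) (fun q ↦ θ (t, q)) y) := fun y ↦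
    Function.LeftInverse.injective
      (g := mfderiv (𝓡 4) (𝓡 4) (fun q ↦ θ (-t, q)) (θ (t, y)))
      (PseudoRiemannianMetric.mfderiv_flow_neg_apply_mfderiv_flow hθ2 hθ0 hθadd t y)
  exact h.image_of_isometry hΦ hΦ' (hiso t) hK.mdifferentiableAt
    (mfderiv_flow_apply_self hθ2 hθ0 hθadd hθX t) _ hx u v w

/-- **The domain of outer communications is static as soon as ONE slice normal to the
stationary Killing field, totally geodesic, sweeps it out under the flow** (steps (S7)–(S8) for
the hypothesis structure `StationaryAFBlackHole`, single-slice form): given a spacelike immersed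
`3`-slice `f : N → M` with future unit normal `ν` (smooth lift), a nowhere-vanishing differentiable
lapse `V` with `T ∘ f = V • ν`, and `K_ν ≡ 0` (`IsTotallyGeodesic`), if `⟨⟨M_ext⟩⟩ ⊆ ⋃ₜ φₜ(f(N))`
(`stationaryOrbit T (range f)`) then `T` is hypersurface-orthogonal on `⟨⟨M_ext⟩⟩`: staticity holds
along the slice (`IsKillingField.twistForm_eq_zero_of_eq_smul_normal`) and spreads along the
flow (`IsHypersurfaceOrthogonalOn.stationaryOrbit`). In print the slice is the Chruściel–Wald
maximal Cauchy surface `Σ''` of `⟨⟨M_ext⟩⟩'`, on which Sudarsky–Wald's identity gives `K = 0`,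
`Z = 0`, `N > 0`, and "moving the `Σ''`'s with the isometry group one covers `⟨⟨M_ext⟩⟩'`"
(Chruściel–Costa 2008, §7.2). [cite: ChruscielCosta2008, §7.2 (last paragraph)] -/
theorem isHypersurfaceOrthogonalOn_doc_of_slice [𝓑.metric.HasLeviCivita]
    {N : Type*} [TopologicalSpace N] [ChartedSpace E3 N] [IsManifold (𝓡 3) ∞ N]
    {f : N → 𝓑.carrier} {ν : NormalField (𝓡 4) f} {V : N → ℝ}
    (hfi : 𝓑.metric.toPseudoRiemannianMetric.IsSpacelikeImmersion (𝓡 3) f)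
    (hun : 𝓑.metric.IsFutureUnitNormal (𝓡 3) 𝓑.timeOrientation f ν)
    (hν : ContMDiff (𝓡 3) (𝓡 4).tangent ∞
      (fun x ↦ (TotalSpace.mk' E4 (f x) (ν x) : TangentBundle (𝓡 4) 𝓑.carrier)))
    (hVd : ∀ y, MDifferentiableAt (𝓡 3) 𝓘(ℝ, ℝ) V y) (hprop : ∀ y, 𝓑.killing (f y) = V y • ν y)
    (hV : ∀ y, V y ≠ 0) (hK : 𝓑.metric.toPseudoRiemannianMetric.IsTotallyGeodesic (𝓡 3) f ν)
    (hcover : 𝓑.doc ⊆ 𝓑.toSpacetime.stationaryOrbit 𝓑.killing (Set.range f)) :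
    𝓑.metric.toPseudoRiemannianMetric.IsHypersurfaceOrthogonalOn 𝓑.killing 𝓑.doc := by
  have hslice : 𝓑.metric.toPseudoRiemannianMetric.IsHypersurfaceOrthogonalOn 𝓑.killing
      (Set.range f) := by
    rintro _ ⟨y, rfl⟩ u v w
    exact 𝓑.isStationaryKilling.isKillingField.twistForm_eq_zero_of_eq_smul_normal hfi hun.1
      (by norm_num) hν (by rw [finrank_euclideanSpace_fin, finrank_euclideanSpace_fin]) hVd hprop
      (hK y) (hV y) u v w
  exact (IsHypersurfaceOrthogonalOn.stationaryOrbit hslice).mono hcover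

end StationaryAFBlackHole

/-- **Reduction of `SudarskyWald1993_staticity` to the existence of the maximal slice with the
Sudarsky–Wald conclusion along it** (steps (S1)–(S6) of Chruściel–Costa 2008, §7.2, and the
covering half of (S8)): if, under the hypotheses of the named fact, there is ONE spacelike
immersed `3`-slice with future unit normal `ν`, to which the stationary Killing field is normal
(`T ∘ f = V ν`, `V ≠ 0`: zero shift, positive lapse) and which is totally geodesic (`K_ν = 0`),
whose flow-orbit `⋃ₜ φₜ(f(N))` contains `⟨⟨M_ext⟩⟩` — in print the Chruściel–Wald maximal Cauchy
surface `Σ''` of `⟨⟨M_ext⟩⟩'` after `∫ N|K|² = 0` and the maximum principle — then the named fact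
holds (`StationaryAFBlackHole.isHypersurfaceOrthogonalOn_doc_of_slice`). A theorem with that
existence as hypothesis, not a discharge of the fact. [cite: ChruscielCosta2008, §7.2] -/
theorem SudarskyWald1993_staticity_of_exists_slice
    (h : ∀ (𝓑 : StationaryAFBlackHole.{0}) [𝓑.metric.HasLeviCivita],
      𝓑.IsIPlusRegular → 𝓑.metric.toPseudoRiemannianMetric.IsRicciFlat → 𝓑.horizon.Nonempty →
      (∀ p ∈ 𝓑.horizon, 𝓑.killing p ≠ 0) →
      (∃ κ : ℝ, κ ≠ 0 ∧ ∀ p ∈ 𝓑.horizon,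
        𝓑.metric.leviCivita 𝓑.killing p (𝓑.killing p) = κ • 𝓑.killing p) →
      ∃ (N : Type) (_ : TopologicalSpace N) (_ : ChartedSpace E3 N) (_ : IsManifold (𝓡 3) ∞ N)
        (f : N → 𝓑.carrier) (ν : NormalField (𝓡 4) f) (V : N → ℝ),
        𝓑.metric.toPseudoRiemannianMetric.IsSpacelikeImmersion (𝓡 3) f ∧
        𝓑.metric.IsFutureUnitNormal (𝓡 3) 𝓑.timeOrientation f ν ∧
        ContMDiff (𝓡 3) (𝓡 4).tangent ∞
          (fun x ↦ (TotalSpace.mk' E4 (f x) (ν x) : TangentBundle (𝓡 4) 𝓑.carrier)) ∧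
        (∀ y, MDifferentiableAt (𝓡 3) 𝓘(ℝ, ℝ) V y) ∧ (∀ y, 𝓑.killing (f y) = V y • ν y) ∧
        (∀ y, V y ≠ 0) ∧ 𝓑.metric.toPseudoRiemannianMetric.IsTotallyGeodesic (𝓡 3) f ν ∧
        𝓑.doc ⊆ 𝓑.toSpacetime.stationaryOrbit 𝓑.killing (Set.range f)) :
    SudarskyWald1993_staticity := by
  intro 𝓑 _ hreg hvac hne hT hκ
  obtain ⟨N, _, _, _, f, ν, V, hfi, hun, hν, hVd, hprop, hV, hK, hcover⟩ :=
    h 𝓑 hreg hvac hne hT hκ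
  exact StationaryAFBlackHole.isHypersurfaceOrthogonalOn_doc_of_slice hfi hun hν hVd hprop hV hK
    hcover

/-! ### Step (S0): the horizon hypothesis of the named fact in the tree's standard form -/

namespace StationaryAFBlackHole

variable {𝓑 : StationaryAFBlackHole.{u}}

/-- **Under the horizon hypothesis of `SudarskyWald1993_staticity` the future event horizon is a
non-degenerate horizon of the stationary Killing field itself** (`IsNonDegenerateHorizon`, the
horizon hypothesis of `ChruscielCosta2008_uniqueness`, with witness `K = T`): `T` is a Killing
field, nowhere zero on `𝓔⁺` (hypothesis), tangent to `𝓔⁺` (its integral curves starting on `𝓔⁺`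
stay there, `mem_horizon_of_isMIntegralCurve` — flow-invariance of `𝓔⁺`), and `∇_T T = κ T` on
`𝓔⁺` with `κ ≠ 0` (hypothesis). This is the opening of the non-rotating case, "by hypothesis
`∇(g(X, X))` has no zeros on `𝓔⁺`, so all components of the future event horizon are
non-degenerate" (Chruściel–Costa 2008, §7.2), in the tree's rendering of non-degeneracy. [cite: ChruscielCosta2008, §7.2 (first paragraph)] -/
theorem isNonDegenerateHorizon_of_killing [𝓑.metric.HasLeviCivita]
    (hne : ∀ p ∈ 𝓑.horizon, 𝓑.killing p ≠ 0)
    (hκ : ∃ κ : ℝ, κ ≠ 0 ∧ ∀ p ∈ 𝓑.horizon,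
      𝓑.metric.leviCivita 𝓑.killing p (𝓑.killing p) = κ • 𝓑.killing p) :
    𝓑.toSpacetime.IsNonDegenerateHorizon 𝓑.Mext :=
  ⟨𝓑.killing, 𝓑.isStationaryKilling.isKillingField, hne,
    fun _ hγ h0 t ↦ mem_horizon_of_isMIntegralCurve hγ h0 t, hκ⟩

/-- **… so the stationary Killing field is null on `𝓔⁺` ("non-rotating": `𝓔⁺` lies in the null
set `𝓝(T)` of `T`)**: `g(T, T) = 0` and `T ≠ 0` at every point of `𝓔⁺`, by the Killing equation
`0 = g(∇_T T, T) = κ g(T, T)` with `κ ≠ 0` (`IsKillingField.val_self_eq_zero_of_leviCivita_eq_smul`).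
Chruściel–Costa 2008, §2.3 ((2.8), surface gravity on `𝓝(X)`) and §7.2; Chruściel–Costa–Heusler
2012, §3.3.1 ("a Killing horizon is called non-rotating if it is generated by the stationary
Killing field"). [cite: ChruscielCosta2008, §2.3 (2.8) and §7.2] -/
theorem isNull_killing_of_mem_horizon [𝓑.metric.HasLeviCivita]
    (hne : ∀ p ∈ 𝓑.horizon, 𝓑.killing p ≠ 0)
    (hκ : ∃ κ : ℝ, κ ≠ 0 ∧ ∀ p ∈ 𝓑.horizon,
      𝓑.metric.leviCivita 𝓑.killing p (𝓑.killing p) = κ • 𝓑.killing p)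
    {p : 𝓑.carrier} (hp : p ∈ 𝓑.horizon) : 𝓑.metric.IsNull (𝓑.killing p) := by
  obtain ⟨κ, hκ0, h⟩ := hκ
  exact ⟨𝓑.isStationaryKilling.isKillingField.val_self_eq_zero_of_leviCivita_eq_smul hκ0 (h p hp),
    hne p hp⟩

/-- With a connected horizon, the hypotheses of `SudarskyWald1993_staticity` place `𝓑` in the
class `IsIPlusRegularNonDegenerate` ("`I⁺`-regular with connected, non-degenerate `𝓔⁺`", the
horizon hypotheses of Chruściel–Costa's Thm. 1.3 without analyticity), witnessed by `T` itself.
Chruściel–Costa 2008, Thm. 1.3 (hypotheses) and §7.2. [cite: ChruscielCosta2008, §7.2 (first paragraph)] -/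
theorem isIPlusRegularNonDegenerate_of_killing (hreg : 𝓑.IsIPlusRegular)
    (hconn : IsConnected 𝓑.horizon) (hne : ∀ p ∈ 𝓑.horizon, 𝓑.killing p ≠ 0)
    (hκ : ∀ [𝓑.metric.HasLeviCivita], ∃ κ : ℝ, κ ≠ 0 ∧ ∀ p ∈ 𝓑.horizon,
      𝓑.metric.leviCivita 𝓑.killing p (𝓑.killing p) = κ • 𝓑.killing p) :
    𝓑.IsIPlusRegularNonDegenerate :=
  ⟨hreg, hconn, fun {_} ↦ isNonDegenerateHorizon_of_killing hne hκ⟩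

end StationaryAFBlackHole

/-! ### Step (S4) with zero shift: a slice everywhere normal to a Killing field is totally
geodesic, and the reductions without the `K = 0` hypothesis -/

namespace PseudoRiemannianMetric

variable {E : Type*} [NormedAddCommGroup E] [NormedSpace ℝ E] {H : Type*} [TopologicalSpace H]
  {I : ModelWithCorners ℝ E H} {M : Type*} [TopologicalSpace M] [ChartedSpace H M]
  [IsManifold I ∞ M] [FiniteDimensional ℝ E] [CompleteSpace E]
  {g : PseudoRiemannianMetric I ∞ E (TangentSpace I : M → Type _)} [g.HasLeviCivita]
  {E' : Type*} [NormedAddCommGroup E'] [NormedSpace ℝ E'] {H' : Type*} [TopologicalSpace H']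
  {I' : ModelWithCorners ℝ E' H'} {N : Type*} [TopologicalSpace N] [ChartedSpace H' N]
  [IsManifold I' ∞ N] [FiniteDimensional ℝ E'] [I'.Boundaryless] {f : N → M}
  {ν : NormalField I f} {ε : ℝ}

/-- **A spacelike slice everywhere normal to a Killing field is totally geodesic where the lapse
does not vanish** — Chruściel–Costa's (7.1) `D_i Z_j + D_j Z_i = -2N K_{ij}` with zero shift: if
`X` is a Killing field and `X ∘ f = V ν` for a normal field `ν` (smooth lift) and a differentiable
`V`, then `-2 V(y) K_ν(y)(u, w) = (f^*g)(∇_u 0, w) + (f^*g)(∇_w 0, u) = 0`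
(`IsKillingField.inducedMetric_val_leviCivita_shift_symm_add` with `Z = 0`), so `K_ν(y) = 0`
wherever `V(y) ≠ 0`. In the Sudarsky–Wald argument this is the converse bookkeeping of its last
step: once `Z = 0` on the maximal slice, `K = 0` is automatic (Chruściel–Costa 2008, §7.2, (7.1);
Wald 1984, (10.2.13) and §E.2: `K_{ab} = ½ N⁻¹(ḣ_{ab} - D_a N_b - D_b N_a)` with `ḣ = 0`,
`N_a = 0`). [cite: ChruscielCosta2008, §7.2 (7.1)] -/
theorem IsKillingField.secondFundamentalForm_eq_zero_of_eq_smul_normal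
    (hfi : g.IsSpacelikeImmersion I' f)
    (hν : ContMDiff I' I.tangent ∞
      (fun x ↦ (TotalSpace.mk' E (f x) (ν x) : TangentBundle I M)))
    (hn : g.IsNormalTo I' f ν)
    {X : Π x : M, TangentSpace I x} (hX : g.IsKillingField X)
    {V : N → ℝ} (hVd : ∀ y, MDifferentiableAt I' 𝓘(ℝ, ℝ) V y)
    (hprop : ∀ y, X (f y) = V y • ν y) {y : N} (hVy : V y ≠ 0) :
    g.secondFundamentalForm I' f ν y = 0 := by
  haveI : CompleteSpace E' := FiniteDimensional.complete ℝ E'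
  have hpb : contMDiff_pullbackBilin I M I' N ∞ := contMDiff_pullbackBilin_holds
  haveI := (g.inducedMetric f hpb hfi).hasLeviCivita
  -- zero shift
  have h0N : ContMDiff I' I'.tangent ∞
      (fun z : N ↦ (TotalSpace.mk' E' z (0 : TangentSpace I' z) : TangentBundle I' N)) :=
    contMDiff_zeroSection ℝ (TangentSpace I' : N → Type _)
  have hZ : ∀ z : N, MDiffAt (T% (fun z : N ↦ (0 : TangentSpace I' z))) z := fun z ↦
    (h0N z).mdifferentiableAt (by simp)
  have hsplit : ∀ z, X (f z) =
      V z • ν z + mfderiv I' I f z ((fun z : N ↦ (0 : TangentSpace I' z)) z) := fun z ↦ by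
    show X (f z) = V z • ν z + mfderiv I' I f z 0
    rw [map_zero, add_zero]; exact hprop z
  have h0 : (g.inducedMetric f hpb hfi).leviCivita (fun z : N ↦ (0 : TangentSpace I' z)) y = 0 :=
    congrFun (CovariantDerivative.zero ((g.inducedMetric f hpb hfi).leviCivita :
      CovariantDerivative I' E' (TangentSpace I' : N → Type _))) y
  refine LinearMap.ext₂ fun u w ↦ ?_
  have h := hX.inducedMetric_val_leviCivita_shift_symm_add g hpb hfi hν hn hVd hZ hsplit y u w
  rw [h0] at h
  have e : ∀ a c : TangentSpace I' y, (g.inducedMetric f hpb hfi).val y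
      ((0 : TangentSpace I' y →L[ℝ] TangentSpace I' y) a) c = 0 := fun a c ↦ by
    rw [show (0 : TangentSpace I' y →L[ℝ] TangentSpace I' y) a = 0 from rfl, map_zero]; rfl
  rw [e, e, zero_add] at h
  rcases mul_eq_zero.1 h.symm with h3 | h3
  · exact absurd h3 (mul_ne_zero (by norm_num) hVy)
  · simpa using h3

/-- **A spacelike slice everywhere normal to a Killing field with nowhere-vanishing lapse is
totally geodesic** (`IsTotallyGeodesic`): the previous lemma at every point.
[cite: ChruscielCosta2008, §7.2 (7.1)] -/
theorem IsKillingField.isTotallyGeodesic_of_eq_smul_normal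
    (hfi : g.IsSpacelikeImmersion I' f)
    (hν : ContMDiff I' I.tangent ∞
      (fun x ↦ (TotalSpace.mk' E (f x) (ν x) : TangentBundle I M)))
    (hn : g.IsNormalTo I' f ν)
    {X : Π x : M, TangentSpace I x} (hX : g.IsKillingField X)
    {V : N → ℝ} (hVd : ∀ y, MDifferentiableAt I' 𝓘(ℝ, ℝ) V y)
    (hprop : ∀ y, X (f y) = V y • ν y) (hV : ∀ y, V y ≠ 0) :
    g.IsTotallyGeodesic I' f ν := fun _ ↦
  hX.secondFundamentalForm_eq_zero_of_eq_smul_normal hfi hν hn hVd hprop (hV _)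

/-- **Staticity along a slice normal to the Killing field, without the `K = 0` hypothesis** (steps
(S4) with `Z = 0` and (S7) combined): for a spacelike immersion `f : Nᵐ → Mᵐ⁺¹` with unit normal
`ν` of sign `ε ≠ 0` (smooth lift), a Killing field `X` with `X ∘ f = V ν`, `V` differentiable, and
a point `y` with `V(y) ≠ 0`, the twist form of `X` vanishes at `f y`. The slice is totally
geodesic at `y` by `secondFundamentalForm_eq_zero_of_eq_smul_normal`, and then
`twistForm_eq_zero_of_eq_smul_normal` applies. [cite: ChruscielCosta2008, §7.2 (last paragraph)] -/
theorem IsKillingField.twistForm_eq_zero_of_eq_smul_normal'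
    (hfi : g.IsSpacelikeImmersion I' f) (hun : g.IsUnitNormal I' f ν ε) (hε : ε ≠ 0)
    (hν : ContMDiff I' I.tangent ∞
      (fun x ↦ (TotalSpace.mk' E (f x) (ν x) : TangentBundle I M)))
    (hdim : Module.finrank ℝ E = Module.finrank ℝ E' + 1)
    {X : Π x : M, TangentSpace I x} (hX : g.IsKillingField X)
    {V : N → ℝ} (hVd : ∀ y, MDifferentiableAt I' 𝓘(ℝ, ℝ) V y)
    (hprop : ∀ y, X (f y) = V y • ν y) {y : N} (hVy : V y ≠ 0)
    (u v w : TangentSpace I (f y)) : g.twistForm X (f y) u v w = 0 :=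
  hX.twistForm_eq_zero_of_eq_smul_normal hfi hun hε hν hdim hVd hprop
    (hX.secondFundamentalForm_eq_zero_of_eq_smul_normal hfi hν hun.isNormalTo hVd hprop hVy)
    hVy u v w

end PseudoRiemannianMetric

namespace StationaryAFBlackHole

variable {𝓑 : StationaryAFBlackHole.{u}}

/-- **Staticity of the d.o.c. from ONE slice normal to the stationary Killing field whose
flow-orbit covers it — no curvature hypothesis on the slice** (steps (S4)⁰, (S7), (S8) for
`StationaryAFBlackHole`): given a spacelike immersed `3`-slice `f : N → M` with future unit normal
`ν` (smooth lift) and a nowhere-vanishing differentiable lapse `V` with `T ∘ f = V • ν`, if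
`⟨⟨M_ext⟩⟩ ⊆ ⋃ₜ φₜ(f(N))` then `T` is hypersurface-orthogonal on `⟨⟨M_ext⟩⟩`. Compared with
`isHypersurfaceOrthogonalOn_doc_of_slice` the hypothesis `K_ν ≡ 0` is dropped: it follows from
`T ∘ f = V ν` by (7.1) (`IsKillingField.isTotallyGeodesic_of_eq_smul_normal`). In print the slice
is the Chruściel–Wald maximal Cauchy surface `Σ''` of `⟨⟨M_ext⟩⟩'` on which Sudarsky–Wald's
identity gives `Z = 0` (Chruściel–Costa 2008, §7.2). [cite: ChruscielCosta2008, §7.2 (last paragraph)] -/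
theorem isHypersurfaceOrthogonalOn_doc_of_normal_slice [𝓑.metric.HasLeviCivita]
    {N : Type*} [TopologicalSpace N] [ChartedSpace E3 N] [IsManifold (𝓡 3) ∞ N]
    {f : N → 𝓑.carrier} {ν : NormalField (𝓡 4) f} {V : N → ℝ}
    (hfi : 𝓑.metric.toPseudoRiemannianMetric.IsSpacelikeImmersion (𝓡 3) f)
    (hun : 𝓑.metric.IsFutureUnitNormal (𝓡 3) 𝓑.timeOrientation f ν)
    (hν : ContMDiff (𝓡 3) (𝓡 4).tangent ∞
      (fun x ↦ (TotalSpace.mk' E4 (f x) (ν x) : TangentBundle (𝓡 4) 𝓑.carrier)))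
    (hVd : ∀ y, MDifferentiableAt (𝓡 3) 𝓘(ℝ, ℝ) V y) (hprop : ∀ y, 𝓑.killing (f y) = V y • ν y)
    (hV : ∀ y, V y ≠ 0)
    (hcover : 𝓑.doc ⊆ 𝓑.toSpacetime.stationaryOrbit 𝓑.killing (Set.range f)) :
    𝓑.metric.toPseudoRiemannianMetric.IsHypersurfaceOrthogonalOn 𝓑.killing 𝓑.doc :=
  isHypersurfaceOrthogonalOn_doc_of_slice hfi hun hν hVd hprop hV
    (𝓑.isStationaryKilling.isKillingField.isTotallyGeodesic_of_eq_smul_normal hfi hν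
      hun.1.isNormalTo hVd hprop hV) hcover

end StationaryAFBlackHole

/-- **Reduction of `SudarskyWald1993_staticity` to the existence of ONE slice normal to the
stationary Killing field whose flow-orbit covers the d.o.c.** (steps (S1)–(S3), (S5)–(S6) and the
covering half of (S8) of Chruściel–Costa 2008, §7.2): if, under the hypotheses of the named fact,
there is a spacelike immersed `3`-slice with future unit normal `ν` (smooth lift) to which `T` is
everywhere normal with nowhere-vanishing lapse (`T ∘ f = V ν`, `V ≠ 0` — in print: the
Chruściel–Wald maximal Cauchy surface `Σ''` of `⟨⟨M_ext⟩⟩'`, after `∫_{Σ''} N|K|² = 0` and the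
maximum principle give `Z = 0`, `N > 0`), and `⟨⟨M_ext⟩⟩ ⊆ ⋃ₜ φₜ(f(N))`, then the named fact
holds. Compared with `SudarskyWald1993_staticity_of_exists_slice`, total geodesy of the slice is
no longer assumed (it follows, `IsKillingField.isTotallyGeodesic_of_eq_smul_normal`). A theorem
with that existence as hypothesis, not a discharge of the fact. [cite: ChruscielCosta2008, §7.2] -/
theorem SudarskyWald1993_staticity_of_exists_normal_slice
    (h : ∀ (𝓑 : StationaryAFBlackHole.{0}) [𝓑.metric.HasLeviCivita],
      𝓑.IsIPlusRegular → 𝓑.metric.toPseudoRiemannianMetric.IsRicciFlat → 𝓑.horizon.Nonempty →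
      (∀ p ∈ 𝓑.horizon, 𝓑.killing p ≠ 0) →
      (∃ κ : ℝ, κ ≠ 0 ∧ ∀ p ∈ 𝓑.horizon,
        𝓑.metric.leviCivita 𝓑.killing p (𝓑.killing p) = κ • 𝓑.killing p) →
      ∃ (N : Type) (_ : TopologicalSpace N) (_ : ChartedSpace E3 N) (_ : IsManifold (𝓡 3) ∞ N)
        (f : N → 𝓑.carrier) (ν : NormalField (𝓡 4) f) (V : N → ℝ),
        𝓑.metric.toPseudoRiemannianMetric.IsSpacelikeImmersion (𝓡 3) f ∧
        𝓑.metric.IsFutureUnitNormal (𝓡 3) 𝓑.timeOrientation f ν ∧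
        ContMDiff (𝓡 3) (𝓡 4).tangent ∞
          (fun x ↦ (TotalSpace.mk' E4 (f x) (ν x) : TangentBundle (𝓡 4) 𝓑.carrier)) ∧
        (∀ y, MDifferentiableAt (𝓡 3) 𝓘(ℝ, ℝ) V y) ∧ (∀ y, 𝓑.killing (f y) = V y • ν y) ∧
        (∀ y, V y ≠ 0) ∧ 𝓑.doc ⊆ 𝓑.toSpacetime.stationaryOrbit 𝓑.killing (Set.range f)) :
    SudarskyWald1993_staticity := by
  intro 𝓑 _ hreg hvac hne hT hκ
  obtain ⟨N, _, _, _, f, ν, V, hfi, hun, hν, hVd, hprop, hV, hcover⟩ := h 𝓑 hreg hvac hne hT hκ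
  exact StationaryAFBlackHole.isHypersurfaceOrthogonalOn_doc_of_normal_slice hfi hun hν hVd hprop hV
    hcover

end Literature.Geometry.Lorentzian

end
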